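import Summits.ResolutionOfSingularities.ResolutionOfSingularities.Theorems.PurelyInseparableDim4ResConeCornerTransport
import Literature.AlgebraicGeometry.Resolution.CentreBlowupOrdAlongBasics
import HarnessLib

/-!
# Purely inseparable four-folds — the C∞ NORMAL-FORM PRESENTATION PERSISTS under pure corner steps
# (K24b-FRAME, file F1 part (P): cell `res-dim4-pi`, K2(p) lane, slice B)

[OURS · counted 0 · cell `res-dim4-pi` · K2(p) lane holder res-dim4-p-12 g3's split of K24b by file (bus
2026-08-29 02:23:39Z): F1 «normal-form presentation» seat res-dim4-typ-1 g2; spec res-dim4-idea-4 g3 HANDOFF-g3 §11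
(C∞(T) tail: `p = 5`, `d = 4`, `e_G ≡ 3`, ledger `(1,1)`, second Tschirnhaus `ū`, `S₀ = B₀ + ū B₁ + ū³ V`).]
Nothing here proves K2(p)/K2(5), `NoIsolatedTrap 5 5` or resolution of singularities in dimension ≥ 4 /
characteristic `p` — NOT proved.  AI kernel work, weaker than expert review.

The C∞ presentation of a state `s` (fixed coordinates: boundary pair `λ, μ` with `r = x_λ x_μ`, free letters
`u, f`) consists of COEFFICIENT CONDITIONS on `s.F` read at exponents `r + m`; this file proves that the two
conditions making up the `ū`-normal form are REPRODUCED VERBATIM by a pure corner step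
`CentreBlowup.step q univ j 0 s` in a boundary chart `j` (no translation), which is what lets the frame-free
C∞ game (res-dim4-p-9 g3's `…ResConeCInfGame`) be fed by exact monomial transport:
* §1 `coeff_step_zero_eq_zero_of_rows` — ROW RIGIDITY (any `q`, any chart `j`): a family of exponents closed
  under «chart preimage» that misses `supp F` misses `supp F′` (res-dim4-p-5 g3's backward transport
  `exists_of_mem_support_step_zero`: every monomial of the child is the chart image of a parent monomial —
  the SUB-IMAGE law, deletions by cleaning allowed).
* §2 `coeff_step_zero_eq_zero_of_normalForm` — the `ū²`-ROW STAYS DEAD: if every reading `r + m` with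
  `m_u = 2`, `m_f = 0` vanishes at the parent (`S₀` has no `ū²`-term, times the ledger factor), then every
  exponent with `u`-exponent `2` and `f`-exponent `0` off the ledger letters is absent from the child, for any
  chart `j ∉ {u, f}` (the chart law moves only the `j`-th exponent).
* §3 `cInf_step_zero_r` — in the C∞ regime numbers (`o = 6`, `r = x_λ x_μ`, chart `j ∈ {λ, μ}`, `q = 5`) the
  ledger is reproduced: `r′ = r` (weight `o − q = 1` on the new letter, the other kept).
* §4 `cInf_coeff_uFlag_step_zero` — the `u`-AXIS FLAG monomial `x^r·x_λ x_μ u³` (`V(0)`, idea-4 §11) is a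
  FIXED POINT of the chart law (degree `7`, `j`-exponent `2 = 7 − 5`) and no `5`-th power (`u`-exponent `3`),
  so its coefficient is carried identically: `V(0) ≠ 0` persists.
What is NOT here: the EXISTENCE of the presentation at the entry state (second Tschirnhaus `ψ ∈ K[x_λ, x_μ]`
degree by degree, char `≠ 3`) and the PINNING lemma ((VT): a child in the regime forces zero translation of
`u` and `f` in a normal-form presentation) — HANDOFF `pub/res-dim4/res-dim4-typ-1/HANDOFF.md` § K24b-FRAME;
files F2/F3 (exponent maps, legality/flag readings) are res-dim4-p-2 g4's.
bears_on: LADDER-RESOLUTION:D157-DOOR2 (res-dim4-pi · K2(p) · slice B · K24b-FRAME F1 (P)).  Supports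
stmt-ResolutionOfSingularities-16155 (helper).
-/

set_option linter.dupNamespace false -- mandated namespace of this single-conjunct summit

namespace Summit.ResolutionOfSingularities.ResolutionOfSingularities.Theorems.PIDim4

namespace ResCone

open MvPolynomial Finset
open Literature.AlgebraicGeometry.Resolution
open Literature.AlgebraicGeometry.Resolution.CentreBlowup
open Literature.AlgebraicGeometry.Resolution.Hauser2010
open Literature.AlgebraicGeometry.Resolution.HauserPerlega2019

variable {K : Type} [Field K] [DecidableEq K]

/-! ## 1. Row rigidity under a pure corner step -/

/-- **Row rigidity** (sub-image law read contrapositively): if a family `R` of exponents is closed under chart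
PREIMAGES (`R (chart image of e) → R e`) and no monomial of `F` lies in `R`, then no monomial of the pure-corner
child lies in `R`. [cite: Hauser2010, §§F–G] -/
theorem coeff_step_zero_eq_zero_of_rows (q : ℕ) (j : Fin 4) (s : State K) {R : (Fin 4 →₀ ℕ) → Prop}
    (hR : ∀ e : Fin 4 →₀ ℕ, R (chartExponent q Finset.univ j e) → R e)
    (hrow : ∀ e ∈ s.F.support, ¬ R e) {E : Fin 4 →₀ ℕ} (hE : R E) :
    coeff E (CentreBlowup.step q Finset.univ j 0 s).F = 0 := by
  by_contra h
  obtain ⟨e, he, heE⟩ := exists_of_mem_support_step_zero j s (mem_support_iff.mpr h)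
  exact hrow e he (hR e (by rw [heE]; exact hE))

/-- Row rigidity for a pair of SPECTATOR letters `u, f ≠ j`: the `(u, f)`-bidegree of every monomial is
preserved by the chart law, so a dead `(u, f)`-row of the parent is dead at the child. [folklore] -/
theorem coeff_step_zero_eq_zero_of_bidegree (q : ℕ) {j u f : Fin 4} (huj : u ≠ j) (hfj : f ≠ j)
    (s : State K) (a c : ℕ) (hrow : ∀ e ∈ s.F.support, ¬ (e u = a ∧ e f = c)) {E : Fin 4 →₀ ℕ}
    (hEu : E u = a) (hEf : E f = c) : coeff E (CentreBlowup.step q Finset.univ j 0 s).F = 0 :=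
  coeff_step_zero_eq_zero_of_rows q j s (R := fun e => e u = a ∧ e f = c)
    (fun e he => by
      rw [chartExponent_apply_of_ne q Finset.univ huj, chartExponent_apply_of_ne q Finset.univ hfj] at he
      exact he)
    hrow ⟨hEu, hEf⟩

/-! ## 2. The `ū²`-row of the normal form stays dead -/

/-- **The `ū`-normal form persists**: if the parent's readings `r + m`, `m_u = 2`, `m_f = 0`, all vanish
(`S₀ = B₀ + ū B₁ + ū³ V` has no `ū²`-term; `r` carries no `u`, `f`), then at the pure-corner child in any
chart `j ∉ {u, f}` every exponent `r′ + m` with `r′_u = r′_f = 0`, `m_u = 2`, `m_f = 0` has coefficient `0` —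
in particular for `r′ =` the child's ledger. [OURS] [cite: CossartJannsenSaito2020, Thm. 9.3 (setting)] -/
theorem coeff_step_zero_eq_zero_of_normalForm (q : ℕ) {j u f : Fin 4} (huj : u ≠ j) (hfj : f ≠ j)
    {s : State K} (hru : s.r u = 0) (hrf : s.r f = 0) (hdiv : ∀ e ∈ s.F.support, s.r ≤ e)
    (hnf : ∀ m : Fin 4 →₀ ℕ, m u = 2 → m f = 0 → coeff (s.r + m) s.F = 0)
    {r' : Fin 4 →₀ ℕ} (hr'u : r' u = 0) (hr'f : r' f = 0) {m : Fin 4 →₀ ℕ} (hmu : m u = 2) (hmf : m f = 0) :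
    coeff (r' + m) (CentreBlowup.step q Finset.univ j 0 s).F = 0 := by
  refine coeff_step_zero_eq_zero_of_bidegree q huj hfj s 2 0 (fun e he hbi => ?_)
    (by rw [Finsupp.add_apply, hr'u, hmu]) (by rw [Finsupp.add_apply, hr'f, hmf])
  -- a parent monomial in the row: divide out the ledger and read it as `r + m₀`
  have hle : s.r ≤ e := hdiv e he
  have he' : e = s.r + (e - s.r) := (add_tsub_cancel_of_le hle).symm
  have hm₀u : (e - s.r) u = 2 := by rw [Finsupp.tsub_apply, hru, hbi.1]
  have hm₀f : (e - s.r) f = 0 := by rw [Finsupp.tsub_apply, hrf, hbi.2]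
  have h0 := hnf (e - s.r) hm₀u hm₀f
  rw [← he'] at h0
  exact (mem_support_iff.mp he) h0

/-! ## 3. The C∞ ledger `(1,1)` is reproduced -/

/-- In the C∞ regime (`o = 6`, `r = x_λ x_μ`, `q = 5`) a pure corner step in a boundary chart `j ∈ {λ, μ}`
reproduces the ledger: `r′ = r` (the new letter `j` gets `o − q = 1`, the other letter is kept untranslated).
[OURS] [cite: Hauser2010, §F] -/
theorem cInf_step_zero_r {lam mu j : Fin 4} (hlm : lam ≠ mu) (hj : j = lam ∨ j = mu) {s : State K}
    (hr : s.r = Finsupp.single lam 1 + Finsupp.single mu 1) (ho : ordZero s.F = 6) :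
    (CentreBlowup.step 5 Finset.univ j 0 s).r = s.r := by
  rw [step_r_univ' 5 j 0 s ho]
  have hfilt : s.r.filter (fun i => (0 : Fin 4 → K) i = 0) = s.r := by
    ext i
    rw [Finsupp.filter_apply, if_pos (Pi.zero_apply i)]
  have hj1 : s.r j = 6 - 5 := by
    rcases hj with rfl | rfl
    · rw [hr, Finsupp.add_apply]; simp [hlm.symm]
    · rw [hr, Finsupp.add_apply]; simp [hlm]
  rw [hfilt, ← hj1, Finsupp.update_self]

/-! ## 4. The `u`-axis flag `V(0) ≠ 0` is carried identically -/

/-- **The `u`-axis flag persists**: in the C∞ regime (`o = 6`, `r = x_λ x_μ`, chart `j ∈ {λ, μ}`, `q = 5`) the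
coefficient of `x^r · x_λ x_μ u³` (the constant term `V(0)` of `V` in `S₀ = B₀ + ū B₁ + ū³ V`) is the SAME at
the pure-corner child: this exponent (degree `7`, `j`-exponent `2`) is fixed by the chart law and is no `5`-th
power. [OURS] [cite: Hauser2010, §§F–G] -/
theorem cInf_coeff_uFlag_step_zero {lam mu u j : Fin 4} (hlm : lam ≠ mu) (hul : u ≠ lam) (hum : u ≠ mu)
    (hj : j = lam ∨ j = mu) {s : State K} (hr : s.r = Finsupp.single lam 1 + Finsupp.single mu 1)
    (ho : ordZero s.F = 6) :
    coeff (s.r + (Finsupp.single lam 1 + Finsupp.single mu 1 + Finsupp.single u 3))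
        (CentreBlowup.step 5 Finset.univ j 0 s).F =
      coeff (s.r + (Finsupp.single lam 1 + Finsupp.single mu 1 + Finsupp.single u 3)) s.F := by
  have hq : ((5 : ℕ) : ℕ∞) ≤ ordAlong Finset.univ s.F := by
    rw [ordAlong_univ, ho]; exact_mod_cast (by norm_num : 5 ≤ 6)
  have huj : u ≠ j := by rcases hj with rfl | rfl <;> assumption
  have hdeg : (s.r + (Finsupp.single lam 1 + Finsupp.single mu 1 + Finsupp.single u 3)).degree = 7 := by
    rw [hr]; simp only [map_add, Finsupp.degree_single]
  have hej : ((s.r + (Finsupp.single lam 1 + Finsupp.single mu 1 + Finsupp.single u 3) :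
      Fin 4 →₀ ℕ)) j = 2 := by
    rcases hj with rfl | rfl
    · rw [hr]; simp [hlm.symm, hul]
    · rw [hr]; simp [hlm, hum]
  have heu : ((s.r + (Finsupp.single lam 1 + Finsupp.single mu 1 + Finsupp.single u 3) :
      Fin 4 →₀ ℕ)) u = 3 := by
    rw [hr]; simp [hul.symm, hum.symm]
  have hce : chartExponent 5 Finset.univ j
      (s.r + (Finsupp.single lam 1 + Finsupp.single mu 1 + Finsupp.single u 3)) =
      s.r + (Finsupp.single lam 1 + Finsupp.single mu 1 + Finsupp.single u 3) := by
    rw [chartExponent, degIn_univ, hdeg, show (7 - 5 : ℕ) = 2 from rfl, ← hej, Finsupp.update_self]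
  have h := coeff_step_zero_chartExponent 5 j s hq
    (e := s.r + (Finsupp.single lam 1 + Finsupp.single mu 1 + Finsupp.single u 3)) (by rw [hdeg]; norm_num)
  rw [hce, if_neg (not_isPthPowerExponent_of_not_dvd (i := u) (by rw [heu]; decide))] at h
  exact h

/-- Hence the `u`-axis flag `V(0) ≠ 0` PERSISTS along a pure corner step of the C∞ regime. [OURS] -/
theorem cInf_uFlag_step_zero {lam mu u j : Fin 4} (hlm : lam ≠ mu) (hul : u ≠ lam) (hum : u ≠ mu)
    (hj : j = lam ∨ j = mu) {s : State K} (hr : s.r = Finsupp.single lam 1 + Finsupp.single mu 1)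
    (ho : ordZero s.F = 6)
    (hV : coeff (s.r + (Finsupp.single lam 1 + Finsupp.single mu 1 + Finsupp.single u 3)) s.F ≠ 0) :
    coeff ((CentreBlowup.step 5 Finset.univ j 0 s).r +
        (Finsupp.single lam 1 + Finsupp.single mu 1 + Finsupp.single u 3))
      (CentreBlowup.step 5 Finset.univ j 0 s).F ≠ 0 := by
  rw [cInf_step_zero_r hlm hj hr ho, cInf_coeff_uFlag_step_zero hlm hul hum hj hr ho]
  exact hV

/-- **F1 (P), packaged**: along a pure corner step of the C∞ regime in a boundary chart the whole normal-form
presentation is reproduced — same ledger `r′ = r = x_λ x_μ`, dead `ū²`-row, live `u`-axis flag. [OURS] -/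
theorem cInf_normalForm_step_zero {lam mu u f j : Fin 4} (hlm : lam ≠ mu) (hul : u ≠ lam) (hum : u ≠ mu)
    (hfl : f ≠ lam) (hfm : f ≠ mu) (hj : j = lam ∨ j = mu) {s : State K}
    (hr : s.r = Finsupp.single lam 1 + Finsupp.single mu 1) (ho : ordZero s.F = 6)
    (hdiv : ∀ e ∈ s.F.support, s.r ≤ e)
    (hnf : ∀ m : Fin 4 →₀ ℕ, m u = 2 → m f = 0 → coeff (s.r + m) s.F = 0)
    (hV : coeff (s.r + (Finsupp.single lam 1 + Finsupp.single mu 1 + Finsupp.single u 3)) s.F ≠ 0) :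
    (CentreBlowup.step 5 Finset.univ j 0 s).r = s.r ∧
      (∀ m : Fin 4 →₀ ℕ, m u = 2 → m f = 0 →
        coeff ((CentreBlowup.step 5 Finset.univ j 0 s).r + m) (CentreBlowup.step 5 Finset.univ j 0 s).F = 0) ∧
      coeff ((CentreBlowup.step 5 Finset.univ j 0 s).r +
          (Finsupp.single lam 1 + Finsupp.single mu 1 + Finsupp.single u 3))
        (CentreBlowup.step 5 Finset.univ j 0 s).F ≠ 0 := by
  have huj : u ≠ j := by rcases hj with rfl | rfl <;> assumption
  have hfj : f ≠ j := by rcases hj with rfl | rfl <;> assumption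
  have hru : s.r u = 0 := by rw [hr]; simp [hul.symm, hum.symm]
  have hrf : s.r f = 0 := by rw [hr]; simp [hfl.symm, hfm.symm]
  refine ⟨cInf_step_zero_r hlm hj hr ho, fun m hmu hmf => ?_, cInf_uFlag_step_zero hlm hul hum hj hr ho hV⟩
  rw [cInf_step_zero_r hlm hj hr ho]
  exact coeff_step_zero_eq_zero_of_normalForm 5 huj hfj hru hrf hdiv hnf hru hrf hmu hmf

end ResCone

end Summit.ResolutionOfSingularities.ResolutionOfSingularities.Theorems.PIDim4
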